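import Mathlib.LinearAlgebra.JordanChevalley
import Literature.NumberTheory.Automorphic.LieAlgebraGLTorusHull
import HarnessLib

/-!
# The Jordan decomposition in the Lie algebra of an algebraic group (Springer 4.4.20)
(trunk T-AUTOMORPHIC, G25 AutomorphicL)

Companion to `LieAlgebraGLDerivation.lean` (the invariant derivations `D_X` of `k[x_{ij}, y]`,
`Lie(G) = {X | D_X 𝓘(G) ⊆ 𝓘(G)}`, `⁅D_X, D_Y⁆ = D_{XY-YX}`, degree bound, monomial eigenvectors
of `D_{diag(s)}`), `RightTranslationGL.lean` (right translations `rTransGL`, the representations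
`rTransRepDeg d` on `k[x, y]_{≤ d}`), `LieAlgebraGLTorusHull.lean` (simultaneous diagonalisation
`exists_conj_diagonal_of_isSemisimple`) and `LieAlgebraGLNilpotentExp.lean`, namespace
`Literature.NumberTheory.Automorphic`, concrete `k`-points vocabulary. Springer, *Linear Algebraic
Groups* (2nd ed.), 4.4.20: for a closed subgroup `G ≤ GL_n` and `X ∈ L(G) ⊆ 𝔤𝔩ₙ` with Jordan
decomposition `X = X_s + X_n` (as a matrix), `X_s, X_n ∈ L(G)`. Proved here over an algebraically
closed field (`mem_lieAlgebraGL_of_isSemisimple_add_isNilpotent`, `exists_jordan_mem_lieAlgebraGL`),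
following Springer's argument through the locally finite action on `k[GL_n]`:

* `iterate_derivation_mul_eq_zero` — iterated Leibniz vanishing for any derivation;
* `exists_iterate_rDeriv_eq_zero` — `D_N` is locally nilpotent on `k[x, y]` for nilpotent `N`
  (`D_N^m x_{ij} = (x N^m)_{ij}`, `rowPoly`), hence **`isNilpotent_rDerivDeg`**: its restriction
  `δ_d(N) = rDerivDeg d N` to `k[x, y]_{≤ d}` is nilpotent;
* `rDeriv_rTransGL` — `D_X ∘ ρ(P) = ρ(P) ∘ D_{P⁻¹ X P}` (right translations conjugate the
  invariant derivations through `Ad`, Springer 4.4.5 (i)); with the monomial eigenbasis of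
  `δ_d(diag s)` (`isSemisimple_rDerivDeg_diagonal`) this gives **`isSemisimple_rDerivDeg`**:
  `δ_d(S)` is semisimple for semisimple `S`;
* `commute_rDerivDeg` — commuting matrices give commuting `δ_d`;
* the assembly: by uniqueness of the Jordan–Chevalley decomposition of `δ_d(X)` (Mathlib
  `Module.End.isNilpotent_isSemisimple_unique`), `δ_d(X_s)` is a polynomial in `δ_d(X)` and so
  preserves `𝓘(G) ∩ k[x, y]_{≤ d}`; thus `D_{X_s} 𝓘(G) ⊆ 𝓘(G)`.

With `LieAlgebraGLTorusHull.lean` (semisimple elements of `𝔤^T` lie in `Lie(T)`) and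
`LieAlgebraGLNilpotentExp.lean` (nilpotent elements of `Lie(G)` exponentiate into `G`) this completes the
characteristic-zero toolkit for `𝔤^T = Lie(T)` (Springer 5.4.7 / 7.6.4 (ii) for reductive `G`).

## Mathlib

`Module.End.exists_isNilpotent_isSemisimple`, `Module.End.isNilpotent_isSemisimple_unique`
(Jordan–Chevalley–Dunford over perfect fields), `LinearMap.charpoly_nilpotent_tfae` (nilpotent iff
locally nilpotent), `Module.End.isSemisimple_of_squarefree_aeval_eq_zero`,
`LinearEquiv.isSemisimple_iff`, `LinearMap.GeneralLinearGroup.toLinearEquiv`, `Algebra.adjoin`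
(`AlgHom.map_adjoin`, `Algebra.commute_of_mem_adjoin_singleton_of_commute`). Mathlib has no
algebraic groups; apart from the two-line helper `apply_mem_of_mem_adjoin_singleton` (the `∀`-form of
`mem_invtSubmodule_of_mem_adjoin` of `JordanDecompositionAlgGroup.lean`, kept local so as not to
import that file — Springer 2.4.8 for group elements — into the Lie-algebra chain; the librarian may
unify them), nothing here duplicates a Mathlib or Literature declaration (searched `rDerivDeg`,
`jordan` + `lieAlgebraGL`, `rowPoly`).

## References

* T. A. Springer, *Linear Algebraic Groups*, 2nd ed., Progress in Mathematics 9, Birkhäuser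
  (1998), 2.3.6, 2.4.8, 4.4.3, 4.4.5 (i), Theorem 4.4.20 (i)–(iii) [SpringerLAG1998].
* A. Borel, *Linear Algebraic Groups*, 2nd ed., GTM 126, Springer (1991), I.4.4.
-/

noncomputable section

open MvPolynomial

namespace Literature.NumberTheory.Automorphic

variable {k : Type*} [Field k] {n : Type*} [Fintype n] [DecidableEq n]

/-! ### Iterated derivations of products -/

section IterateDerivation

variable {A : Type*} [CommRing A] [Algebra k A] (D : Derivation k A A)

omit [Fintype n] [DecidableEq n] in
/-- Iterates of a derivation are additive. [folklore] -/
lemma iterate_derivation_add (N : ℕ) (a b : A) : D^[N] (a + b) = D^[N] a + D^[N] b := by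
  induction N generalizing a b with
  | zero => rfl
  | succ N ih => rw [Function.iterate_succ_apply, Function.iterate_succ_apply,
      Function.iterate_succ_apply, map_add, ih]

omit [Fintype n] [DecidableEq n] in
/-- Iterates of a derivation kill `0`. [folklore] -/
lemma iterate_derivation_zero (N : ℕ) : D^[N] (0 : A) = 0 := by
  induction N with
  | zero => rfl
  | succ N ih => rw [Function.iterate_succ_apply, map_zero, ih]

omit [Fintype n] [DecidableEq n] in
/-- If `D^K a = 0` then `D^{K + j} a = 0`. [folklore] -/
lemma iterate_derivation_eq_zero_of_le {K K' : ℕ} (hKK' : K ≤ K') {a : A} (ha : D^[K] a = 0) :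
    D^[K'] a = 0 := by
  obtain ⟨j, rfl⟩ := Nat.exists_eq_add_of_le hKK'
  rw [add_comm, Function.iterate_add_apply, ha, iterate_derivation_zero]

omit [Fintype n] [DecidableEq n] in
/-- **Iterated Leibniz vanishing**: if `D^K a = 0` and `D^M b = 0` then `D^N (a b) = 0` as soon as
`K + M ≤ N + 1` (every term `D^i a D^j b`, `i + j = N`, of the iterated Leibniz expansion has
`i ≥ K` or `j ≥ M`). [folklore] -/
theorem iterate_derivation_mul_eq_zero :
    ∀ (N K M : ℕ) (a b : A), D^[K] a = 0 → D^[M] b = 0 → K + M ≤ N + 1 → D^[N] (a * b) = 0 := by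
  intro N
  induction N with
  | zero =>
    intro K M a b ha hb hKM
    rcases Nat.eq_zero_or_pos K with rfl | hK
    · rw [Function.iterate_zero, id] at ha
      rw [ha, zero_mul]; rfl
    · have hM : M = 0 := by omega
      subst hM
      rw [Function.iterate_zero, id] at hb
      rw [hb, mul_zero]; rfl
  | succ N ih =>
    intro K M a b ha hb hKM
    rcases Nat.eq_zero_or_pos K with rfl | hK
    · rw [Function.iterate_zero, id] at ha
      rw [ha, zero_mul, iterate_derivation_zero]
    rcases Nat.eq_zero_or_pos M with rfl | hM
    · rw [Function.iterate_zero, id] at hb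
      rw [hb, mul_zero, iterate_derivation_zero]
    obtain ⟨K', rfl⟩ := Nat.exists_eq_add_of_le hK
    obtain ⟨M', rfl⟩ := Nat.exists_eq_add_of_le hM
    rw [Function.iterate_succ_apply, Derivation.leibniz, smul_eq_mul, smul_eq_mul,
      iterate_derivation_add]
    have h1 : D^[N] (a * D b) = 0 := by
      refine ih (1 + K') M' a (D b) ha ?_ (by omega)
      rw [← Function.iterate_succ_apply, Nat.succ_eq_add_one, add_comm]; exact hb
    have h2 : D^[N] (b * D a) = 0 := by
      refine ih (1 + M') K' b (D a) hb ?_ (by omega)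
      rw [← Function.iterate_succ_apply, Nat.succ_eq_add_one, add_comm]; exact ha
    rw [h1, h2, add_zero]

end IterateDerivation

/-! ### `D_N` is locally nilpotent for nilpotent `N` -/

section Nilpotent

/-- The linear polynomial `∑ₗ x_{il} A_{lj}` — the `(i, j)` entry of `x A` for a constant matrix
`A`. [folklore] -/
def rowPoly (A : Matrix n n k) (i j : n) : MvPolynomial (GLCoord n) k :=
  ∑ l, MvPolynomial.X (Sum.inl (i, l)) * C (A l j)

omit [DecidableEq n] in
/-- `D_X (x_{ij}) = (x X)_{ij}`. [folklore] -/
lemma rDerivVal_inl_eq_rowPoly (X : Matrix n n k) (i j : n) :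
    rDerivVal X (Sum.inl (i, j)) = rowPoly X i j := rfl

omit [DecidableEq n] in
/-- `D_X ((x A)_{ij}) = (x X A)_{ij}`. [folklore] -/
lemma rDeriv_rowPoly (X A : Matrix n n k) (i j : n) :
    rDeriv X (rowPoly A i j) = rowPoly (X * A) i j := by
  have h : ∀ l, rDeriv X (MvPolynomial.X (Sum.inl (i, l)) * C (A l j)) =
      C (A l j) * ∑ m, MvPolynomial.X (Sum.inl (i, m)) * C (X m l) := fun l => by
    rw [Derivation.leibniz, rDeriv_C, smul_zero, zero_add, rDeriv_X, smul_eq_mul]; rfl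
  simp only [rowPoly, map_sum, h, Matrix.mul_apply, Finset.mul_sum, map_mul]
  rw [Finset.sum_comm]
  refine Finset.sum_congr rfl fun m _ => Finset.sum_congr rfl fun l _ => by ring

/-- `(x 1)_{ij} = x_{ij}`. [folklore] -/
lemma rowPoly_one (i j : n) : rowPoly (1 : Matrix n n k) i j = MvPolynomial.X (Sum.inl (i, j)) := by
  rw [rowPoly, Finset.sum_eq_single j]
  · rw [Matrix.one_apply_eq, C_1, mul_one]
  · intro l _ hl; rw [Matrix.one_apply_ne hl, C_0, mul_zero]
  · intro h; exact absurd (Finset.mem_univ j) h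

omit [DecidableEq n] in
/-- `(x 0)_{ij} = 0`. [folklore] -/
lemma rowPoly_zero (i j : n) : rowPoly (0 : Matrix n n k) i j = 0 := by
  simp [rowPoly]

/-- `D_X^m (x_{ij}) = (x X^m)_{ij}`. [folklore] -/
lemma iterate_rDeriv_X_inl (X : Matrix n n k) (m : ℕ) (i j : n) :
    (rDeriv X)^[m] (MvPolynomial.X (Sum.inl (i, j))) = rowPoly (X ^ m) i j := by
  induction m with
  | zero => rw [Function.iterate_zero, id, pow_zero, rowPoly_one]
  | succ m ih => rw [Function.iterate_succ_apply', ih, rDeriv_rowPoly, pow_succ']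

/-- **`D_N` is locally nilpotent on `k[x_{ij}, y]` for a nilpotent matrix `N`**: every polynomial
is killed by some power of `D_N` (`D_N^m x = x N^m`, `D_N y = -tr(N) y = 0`, and iterated
Leibniz). [folklore] -/
theorem exists_iterate_rDeriv_eq_zero {N : Matrix n n k} (hN : IsNilpotent N)
    (p : MvPolynomial (GLCoord n) k) : ∃ K : ℕ, (rDeriv N)^[K] p = 0 := by
  obtain ⟨M₀, hM₀⟩ := hN
  induction p using MvPolynomial.induction_on with
  | C a => exact ⟨1, by rw [Function.iterate_one, rDeriv_C]⟩
  | add p q hp hq =>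
    obtain ⟨K₁, hK₁⟩ := hp
    obtain ⟨K₂, hK₂⟩ := hq
    refine ⟨K₁ + K₂, ?_⟩
    rw [iterate_derivation_add,
      iterate_derivation_eq_zero_of_le _ (Nat.le_add_right K₁ K₂) hK₁,
      iterate_derivation_eq_zero_of_le _ (Nat.le_add_left K₂ K₁) hK₂, add_zero]
  | mul_X p c hp =>
    obtain ⟨K, hK⟩ := hp
    have hc : ∃ M, (rDeriv N)^[M] (MvPolynomial.X c : MvPolynomial (GLCoord n) k) = 0 := by
      rcases c with ⟨i, j⟩ | u
      · exact ⟨M₀, by rw [iterate_rDeriv_X_inl, hM₀, rowPoly_zero]⟩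
      · refine ⟨1, ?_⟩
        rw [Function.iterate_one, rDeriv_X, rDerivVal, (Matrix.isNilpotent_trace_of_isNilpotent ⟨M₀, hM₀⟩).eq_zero,
          neg_zero, C_0, zero_mul]
    obtain ⟨M, hM⟩ := hc
    exact ⟨K + M, iterate_derivation_mul_eq_zero _ _ K M _ _ hK hM (Nat.le_succ _)⟩

end Nilpotent

/-! ### Conjugation: `D_X ∘ ρ(P) = ρ(P) ∘ D_{P⁻¹ X P}` -/

section Conjugation

/-- `ρ(P)` on a coordinate `x_{ij}` is `(x P)_{ij}`. [folklore] -/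
lemma rTransGL_X_inl (P : GL n k) (i j : n) :
    rTransGL P (MvPolynomial.X (Sum.inl (i, j))) = rowPoly (P : Matrix n n k) i j := by
  rw [rTransGL, MvPolynomial.bind₁_X_right]
  rfl

/-- `ρ(P)` on the coordinate `y` is `det(P)⁻¹ y`. [folklore] -/
lemma rTransGL_X_inr (P : GL n k) (u : Unit) :
    rTransGL P (MvPolynomial.X (Sum.inr u)) =
      MvPolynomial.X (Sum.inr ()) * C ((P : Matrix n n k).det)⁻¹ := by
  rw [rTransGL, MvPolynomial.bind₁_X_right]
  rfl

/-- `ρ(P)` on `(x A)_{ij}` is `(x P A)_{ij}`. [folklore] -/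
lemma rTransGL_rowPoly (P : GL n k) (A : Matrix n n k) (i j : n) :
    rTransGL P (rowPoly A i j) = rowPoly ((P : Matrix n n k) * A) i j := by
  simp only [rowPoly, map_sum, map_mul, rTransGL_X_inl, MvPolynomial.algHom_C,
    MvPolynomial.algebraMap_eq, Finset.sum_mul, Matrix.mul_apply, map_sum, Finset.mul_sum]
  rw [Finset.sum_comm]
  refine Finset.sum_congr rfl fun m _ => Finset.sum_congr rfl fun l _ => by ring

/-- `D_X (ρ(P) x_c) = ρ(P) (D_{P⁻¹ X P} x_c)` on the coordinates (the generator case of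
`rDeriv_rTransGL`). [cite: SpringerLAG1998, 4.4.5 (i)] -/
theorem rDeriv_rTransGL_X (X : Matrix n n k) (P : GL n k) (c : GLCoord n) :
    rDeriv X (rTransGL P (MvPolynomial.X c)) =
      rTransGL P (rDeriv (((P⁻¹ : GL n k) : Matrix n n k) * X * (P : Matrix n n k)) (MvPolynomial.X c)) := by
  rcases c with ⟨i, j⟩ | u
  · rw [rTransGL_X_inl, rDeriv_rowPoly, rDeriv_X, rDerivVal_inl_eq_rowPoly, rTransGL_rowPoly,
      ← Matrix.mul_assoc, ← Matrix.mul_assoc, ← Units.val_mul, mul_inv_cancel, Units.val_one,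
      Matrix.one_mul]
  · have htr : Matrix.trace (((P⁻¹ : GL n k) : Matrix n n k) * X * (P : Matrix n n k)) =
        Matrix.trace X := by
      rw [Matrix.trace_mul_cycle, ← Units.val_mul, mul_inv_cancel, Units.val_one, Matrix.one_mul]
    rw [rTransGL_X_inr, Derivation.leibniz, rDeriv_C, smul_zero, zero_add, rDeriv_X, smul_eq_mul,
      rDeriv_X, rDerivVal, rDerivVal, htr, map_mul, MvPolynomial.algHom_C, MvPolynomial.algebraMap_eq,
      rTransGL_X_inr]
    ring

/-- **Right translations conjugate the invariant derivations by `Ad`**: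
`D_X (ρ(P) p) = ρ(P) (D_{P⁻¹ X P} p)` — differentiating `p (g (1 + s X) P) = p (g P (1 + s P⁻¹ X P))`
(Springer 4.4.5 (i): `Ad(x)` on `L(G)` is induced by `Int(x)`; `rDeriv_rTransGL_X` is the case of
a coordinate). [cite: SpringerLAG1998, 4.4.5 (i)] -/
theorem rDeriv_rTransGL (X : Matrix n n k) (P : GL n k) (p : MvPolynomial (GLCoord n) k) :
    rDeriv X (rTransGL P p) =
      rTransGL P (rDeriv (((P⁻¹ : GL n k) : Matrix n n k) * X * (P : Matrix n n k)) p) := by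
  induction p using MvPolynomial.induction_on with
  | C a => rw [MvPolynomial.algHom_C, MvPolynomial.algebraMap_eq, rDeriv_C, rDeriv_C, map_zero]
  | add p q hp hq => rw [map_add, map_add, hp, hq, map_add, map_add]
  | mul_X p c hp =>
    set X' := ((P⁻¹ : GL n k) : Matrix n n k) * X * (P : Matrix n n k) with hX'
    have h1 : rDeriv X (rTransGL P (p * MvPolynomial.X c)) =
        rTransGL P p * rDeriv X (rTransGL P (MvPolynomial.X c)) +
          rTransGL P (MvPolynomial.X c) * rDeriv X (rTransGL P p) := by
      rw [map_mul, Derivation.leibniz, smul_eq_mul, smul_eq_mul]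
    have h2 : rDeriv X' (p * MvPolynomial.X c) =
        p * rDeriv X' (MvPolynomial.X c) + MvPolynomial.X c * rDeriv X' p := by
      rw [Derivation.leibniz, smul_eq_mul, smul_eq_mul]
    rw [h1, h2, hp, rDeriv_rTransGL_X, map_add, map_mul, map_mul]

end Conjugation

/-! ### The operators `δ_d(X) = D_X|_{k[x, y]_{≤ d}}` -/

section Restrict

variable (d : ℕ)

/-- The restriction `δ_d(X)` of `D_X` to the finite-dimensional subspace `k[x_{ij}, y]_{≤ d}` of
polynomials of total degree `≤ d` (`rDeriv_mem_restrictTotalDegree`; Springer 2.3.6 (i) / 4.4.3: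
local finiteness). [folklore] -/
def rDerivDeg (X : Matrix n n k) : Module.End k (restrictTotalDegree (GLCoord n) k d) :=
  (rDeriv X).toLinearMap.restrict fun _ hp => rDeriv_mem_restrictTotalDegree X hp

omit [DecidableEq n] in
/-- `δ_d(X) p = D_X p`. [folklore] -/
@[simp] lemma coe_rDerivDeg_apply (X : Matrix n n k) (p : restrictTotalDegree (GLCoord n) k d) :
    ((rDerivDeg d X p : restrictTotalDegree (GLCoord n) k d) : MvPolynomial (GLCoord n) k) =
      rDeriv X p := rfl

omit [DecidableEq n] in
/-- `δ_d(X)^K p = D_X^K p`. [folklore] -/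
lemma coe_pow_rDerivDeg_apply (X : Matrix n n k) (K : ℕ) (p : restrictTotalDegree (GLCoord n) k d) :
    (((rDerivDeg d X ^ K) p : restrictTotalDegree (GLCoord n) k d) : MvPolynomial (GLCoord n) k) =
      (rDeriv X)^[K] p := by
  induction K with
  | zero => rfl
  | succ K ih => rw [pow_succ', Module.End.mul_apply, coe_rDerivDeg_apply, ih,
      Function.iterate_succ_apply']

omit [DecidableEq n] in
/-- `δ_d` is additive in `X`. [folklore] -/
lemma rDerivDeg_add (X Y : Matrix n n k) : rDerivDeg d (X + Y) = rDerivDeg d X + rDerivDeg d Y := by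
  refine LinearMap.ext fun p => Subtype.ext ?_
  simp [rDeriv_add]

omit [DecidableEq n] in
/-- Commuting matrices give commuting `δ_d` (`⁅D_X, D_Y⁆ = D_{XY - YX} = 0`). [folklore] -/
lemma commute_rDerivDeg {X Y : Matrix n n k} (h : X * Y = Y * X) :
    Commute (rDerivDeg d X) (rDerivDeg d Y) := by
  have h0 : ⁅rDeriv X, rDeriv Y⁆ = 0 := by rw [rDeriv_commutator, h, sub_self, rDeriv_zero]
  refine LinearMap.ext fun p => Subtype.ext ?_
  have hp := congrArg (fun D : Derivation k _ _ => D (p : MvPolynomial (GLCoord n) k)) h0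
  simp only [Derivation.commutator_apply, Derivation.zero_apply, sub_eq_zero] at hp
  simpa using hp

/-- **`δ_d(N)` is nilpotent for nilpotent `N`** (`D_N` is locally nilpotent,
`exists_iterate_rDeriv_eq_zero`, and `k[x, y]_{≤ d}` is finite-dimensional). [folklore] -/
theorem isNilpotent_rDerivDeg {N : Matrix n n k} (hN : IsNilpotent N) : IsNilpotent (rDerivDeg d N) := by
  refine ((LinearMap.charpoly_nilpotent_tfae (rDerivDeg d N)).out 0 2).2 fun p => ?_
  obtain ⟨K, hK⟩ := exists_iterate_rDeriv_eq_zero hN (p : MvPolynomial (GLCoord n) k)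
  exact ⟨K, Subtype.ext (by rw [coe_pow_rDerivDeg_apply, hK]; rfl)⟩

/-- **`δ_d(diag s)` is semisimple**: the monomials of degree `≤ d` are a basis of eigenvectors
(`rDeriv_diagonal_monomial`), so a product of distinct linear factors kills it. [folklore] -/
theorem isSemisimple_rDerivDeg_diagonal (s : n → k) :
    (rDerivDeg d (Matrix.diagonal s)).IsSemisimple := by
  classical
  set R := rDerivDeg (k := k) d (Matrix.diagonal s) with hR
  set wt : (GLCoord n →₀ ℕ) → k := fun m => m.sum fun c e => (e : k) * rDerivWeight s c with hwt
  set W : Finset k := (Finsupp.finite_of_degree_le (σ := GLCoord n) d).toFinset.image wt with hW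
  set q : Polynomial k := ∏ μ ∈ W, (Polynomial.X - Polynomial.C μ) with hq
  have hqsep : q.Separable := Polynomial.separable_prod_X_sub_C_iff'.2 fun x _ y _ h => h
  refine Module.End.isSemisimple_of_squarefree_aeval_eq_zero hqsep.squarefree ?_
  apply LinearMap.ext
  intro p
  apply Subtype.ext
  rw [LinearMap.zero_apply, Submodule.coe_zero]
  have hp : (p : MvPolynomial (GLCoord n) k) ∈ restrictTotalDegree (GLCoord n) k d := p.2
  have hmem : ∀ m ∈ (p : MvPolynomial (GLCoord n) k).support, ∀ c : k,
      monomial m c ∈ restrictTotalDegree (GLCoord n) k d := by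
    intro m hm c
    rw [mem_restrictTotalDegree]
    refine (totalDegree_monomial_le _ _).trans ?_
    exact (le_totalDegree hm).trans ((mem_restrictTotalDegree _ _ _).1 hp)
  have hmono : ∀ m (hm : m ∈ (p : MvPolynomial (GLCoord n) k).support) (c : k),
      Polynomial.aeval R q ⟨monomial m c, hmem m hm c⟩ = 0 := by
    intro m hm c
    have hev : R ⟨monomial m c, hmem m hm c⟩ = wt m • ⟨monomial m c, hmem m hm c⟩ := by
      apply Subtype.ext
      rw [hR, coe_rDerivDeg_apply, Submodule.coe_smul, rDeriv_diagonal_monomial]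
    have hvec : Polynomial.aeval R q ⟨monomial m c, hmem m hm c⟩ =
        q.eval (wt m) • ⟨monomial m c, hmem m hm c⟩ := by
      by_cases h0 : (⟨monomial m c, hmem m hm c⟩ : restrictTotalDegree (GLCoord n) k d) = 0
      · rw [h0, map_zero, smul_zero]
      · exact Module.End.aeval_apply_of_hasEigenvector ⟨Module.End.mem_eigenspace_iff.2 hev, h0⟩
    rw [hvec, hq, Polynomial.eval_prod]
    have hdeg : m ∈ (Finsupp.finite_of_degree_le (σ := GLCoord n) d).toFinset := by
      rw [Set.Finite.mem_toFinset, Set.mem_setOf_eq]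
      exact (le_totalDegree hm).trans ((mem_restrictTotalDegree _ _ _).1 hp)
    have h0 : ∏ μ ∈ W, (Polynomial.X - Polynomial.C μ).eval (wt m) = 0 := by
      refine Finset.prod_eq_zero (i := wt m) (Finset.mem_image_of_mem wt hdeg) ?_
      simp
    rw [h0, zero_smul]
  have hpeq : p = ∑ m ∈ (p : MvPolynomial (GLCoord n) k).support.attach,
      (⟨monomial m.1 ((p : MvPolynomial (GLCoord n) k).coeff m.1), hmem m.1 m.2 _⟩ :
        restrictTotalDegree (GLCoord n) k d) := by
    apply Subtype.ext
    rw [Submodule.coe_sum]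
    conv_lhs => rw [← support_sum_monomial_coeff (p : MvPolynomial (GLCoord n) k)]
    rw [← Finset.sum_attach]
  rw [hpeq, map_sum, Submodule.coe_sum]
  refine Finset.sum_eq_zero fun m _ => ?_
  rw [hmono m.1 m.2, Submodule.coe_zero]

/-- The linear automorphism `ρ_d(P)` of `k[x, y]_{≤ d}` (right translation by `P ∈ GL_n`).
[folklore] -/
def rTransEquivDeg (P : GL n k) :
    restrictTotalDegree (GLCoord n) k d ≃ₗ[k] restrictTotalDegree (GLCoord n) k d :=
  LinearMap.GeneralLinearGroup.toLinearEquiv ((rTransRepDeg (k := k) d).toHomUnits P)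

/-- `ρ_d(P) p = ρ(P) p`. [folklore] -/
@[simp] lemma coe_rTransEquivDeg_apply (P : GL n k) (p : restrictTotalDegree (GLCoord n) k d) :
    ((rTransEquivDeg d P p : restrictTotalDegree (GLCoord n) k d) : MvPolynomial (GLCoord n) k) =
      rTransGL P p := rfl

/-- **`δ_d(X)` is semisimple for a diagonalisable `X`**: `ρ_d(P)` intertwines `δ_d(P⁻¹ Δ P)` with
`δ_d(Δ)` (`rDeriv_rTransGL`), and `δ_d(Δ)` is semisimple for diagonal `Δ`. [folklore] -/
theorem isSemisimple_rDerivDeg_of_conj_eq_diagonal {X : Matrix n n k} (P : GL n k) {s : n → k}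
    (hX : (P : Matrix n n k) * X * ((P⁻¹ : GL n k) : Matrix n n k) = Matrix.diagonal s) :
    (rDerivDeg d X).IsSemisimple := by
  have hX' : X = ((P⁻¹ : GL n k) : Matrix n n k) * Matrix.diagonal s * (P : Matrix n n k) := by
    rw [← hX, ← Matrix.mul_assoc, ← Matrix.mul_assoc, Units.inv_mul, Matrix.one_mul, Matrix.mul_assoc,
      Units.inv_mul, Matrix.mul_one]
  refine (LinearEquiv.isSemisimple_iff (rDerivDeg d X) (rDerivDeg d (Matrix.diagonal s))
    (rTransEquivDeg d P) ?_).2 (isSemisimple_rDerivDeg_diagonal d s)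
  refine LinearMap.ext fun p => Subtype.ext ?_
  simp only [LinearMap.coe_comp, LinearEquiv.coe_coe, Function.comp_apply, coe_rTransEquivDeg_apply,
    coe_rDerivDeg_apply]
  rw [rDeriv_rTransGL, ← hX']

/-- **`δ_d(S)` is semisimple for a semisimple matrix `S`** over an algebraically closed field
(diagonalise `S`, `exists_conj_diagonal_of_isSemisimple`). [folklore] -/
theorem isSemisimple_rDerivDeg [IsAlgClosed k] {S : Matrix n n k}
    (hS : Module.End.IsSemisimple (Matrix.toLin' S)) : (rDerivDeg d S).IsSemisimple := by
  obtain ⟨g, s, -, hgS⟩ := exists_conj_diagonal_of_isSemisimple (T := (⊥ : Subgroup (GL n k)))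
    ⟨⟨fun a b => Subsingleton.elim _ _⟩⟩ (fun t ht => by
      rw [Subgroup.mem_bot] at ht; subst ht; simp [IsSemisimpleElt, Module.End.isSemisimple_id]) hS
    (fun t ht => by rw [Subgroup.mem_bot] at ht; subst ht; simp)
  exact isSemisimple_rDerivDeg_of_conj_eq_diagonal d g hgS

end Restrict

/-! ### The Jordan parts of an element of `Lie(G)` lie in `Lie(G)` -/

section Jordan

variable {G : Subgroup (GL n k)}

/-- Elements of `k[f]` preserve every `f`-stable subspace. This is the `∀ w ∈ W`-form of
`mem_invtSubmodule_of_mem_adjoin` (`JordanDecompositionAlgGroup.lean`, stated with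
`Module.End.invtSubmodule`), duplicated here only to avoid importing that file. [folklore] -/
lemma apply_mem_of_mem_adjoin_singleton {V : Type*} [AddCommGroup V] [Module k V] {f : Module.End k V}
    {W : Submodule k V} (hW : ∀ w ∈ W, f w ∈ W) {g : Module.End k V} (hg : g ∈ Algebra.adjoin k {f}) :
    ∀ w ∈ W, g w ∈ W := by
  induction hg using Algebra.adjoin_induction with
  | mem x hx => rw [Set.mem_singleton_iff.1 hx]; exact hW
  | algebraMap r => intro w hw; rw [Module.algebraMap_end_apply]; exact W.smul_mem r hw
  | add x y _ _ hx hy => intro w hw; rw [LinearMap.add_apply]; exact W.add_mem (hx w hw) (hy w hw)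
  | mul x y _ _ hx hy => intro w hw; rw [Module.End.mul_apply]; exact hx _ (hy w hw)

/-- **The Jordan decomposition is compatible with `Lie(G)`** (Springer, *Linear Algebraic Groups*,
4.4.20 (i)–(iii): for `X ∈ L(G)`, `G ≤ GL_n` closed, the semisimple and nilpotent parts of the
matrix `X` lie in `L(G)`; Borel, *Linear Algebraic Groups*, I.4.4). Here over
an algebraically closed field, for any subgroup `G` (since `Lie(G) = Lie(closure G)`): if
`X = S + N ∈ Lie(G)` with `S` semisimple, `N` nilpotent and `S N = N S`, then `S, N ∈ Lie(G)`.
Proof (Springer's, via the right translations): on each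
`k[x, y]_{≤ d}` the operator `δ_d(X) = D_X|` has Jordan parts `δ_d(S)` (semisimple,
`isSemisimple_rDerivDeg`) and `δ_d(N)` (nilpotent, `isNilpotent_rDerivDeg`), commuting; by
uniqueness of the Jordan–Chevalley decomposition (Mathlib `Module.End.isNilpotent_isSemisimple_unique`)
`δ_d(S)` is a polynomial in `δ_d(X)`, hence preserves the `D_X`-stable subspace
`𝓘(G) ∩ k[x, y]_{≤ d}`; so `D_S 𝓘(G) ⊆ 𝓘(G)` and `S ∈ Lie(G)`
(`mem_lieAlgebraGL_iff_forall_rDeriv_mem`). [cite: SpringerLAG1998, 4.4.20] -/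
theorem mem_lieAlgebraGL_of_isSemisimple_add_isNilpotent [IsAlgClosed k] {X S N : Matrix n n k}
    (hX : X ∈ lieAlgebraGL G) (hS : Module.End.IsSemisimple (Matrix.toLin' S)) (hN : IsNilpotent N)
    (hSN : S * N = N * S) (hXSN : X = S + N) : S ∈ lieAlgebraGL G ∧ N ∈ lieAlgebraGL G := by
  suffices hSG : S ∈ lieAlgebraGL G by
    refine ⟨hSG, ?_⟩
    have h : N = X - S := by rw [hXSN, add_sub_cancel_left]
    rw [h]
    exact (lieAlgebraGL G).sub_mem hX hSG
  rw [mem_lieAlgebraGL_iff_forall_rDeriv_mem]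
  intro p hp
  set d := p.totalDegree with hd
  -- the `δ_d(X)`-stable subspace `𝓘(G) ∩ k[x, y]_{≤ d}`
  let W : Submodule k (restrictTotalDegree (GLCoord n) k d) :=
    ((idealGL G).restrictScalars k).comap (restrictTotalDegree (GLCoord n) k d).subtype
  have hW : ∀ w ∈ W, rDerivDeg d X w ∈ W := fun w hw => rDeriv_mem_idealGL hX hw
  -- Jordan decomposition of `δ_d(X)` and its uniqueness
  obtain ⟨n₀, hn₀, s₀, hs₀, hn₀n, hs₀s, hf⟩ := (rDerivDeg d X).exists_isNilpotent_isSemisimple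
  have hc₀ : Commute n₀ s₀ :=
    (Algebra.commute_of_mem_adjoin_singleton_of_commute hn₀
      (Algebra.commute_of_mem_adjoin_self hs₀).symm).symm
  have hc₁ : Commute (rDerivDeg d N) (rDerivDeg d S) := commute_rDerivDeg d (by rw [hSN])
  have hsum : n₀ + s₀ = rDerivDeg d N + rDerivDeg d S := by
    rw [← hf, hXSN, rDerivDeg_add, add_comm]
  obtain ⟨-, hs₀S⟩ := Module.End.isNilpotent_isSemisimple_unique hn₀n hs₀s
    (isNilpotent_rDerivDeg d hN) (isSemisimple_rDerivDeg d hS) hc₀ hc₁ hsum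
  -- `δ_d(S) = s₀ ∈ k[δ_d(X)]` preserves `W`
  have hpW : (⟨p, (mem_restrictTotalDegree _ _ _).2 le_rfl⟩ : restrictTotalDegree (GLCoord n) k d) ∈ W :=
    hp
  have h := apply_mem_of_mem_adjoin_singleton hW hs₀ _ hpW
  rw [hs₀S] at h
  exact h

/-- **Jordan decomposition inside `Lie(G)`** (Springer 4.4.20): over an algebraically closed field,
every `X ∈ Lie(G)` is `X = S + N` with `S, N ∈ Lie(G)`, `S` semisimple, `N` nilpotent, both
polynomials in `X` (hence commuting with `X`, with each other, and with everything commuting with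
`X`). The matrix-level decomposition is Mathlib's `Module.End.exists_isNilpotent_isSemisimple`
(Jordan–Chevalley–Dunford), transported along `Matrix.toLin'`. [cite: SpringerLAG1998, 4.4.20] -/
theorem exists_jordan_mem_lieAlgebraGL [IsAlgClosed k] {X : Matrix n n k} (hX : X ∈ lieAlgebraGL G) :
    ∃ S N : Matrix n n k, S ∈ lieAlgebraGL G ∧ N ∈ lieAlgebraGL G ∧
      Module.End.IsSemisimple (Matrix.toLin' S) ∧ IsNilpotent N ∧ X = S + N ∧
      S ∈ Algebra.adjoin k {X} ∧ N ∈ Algebra.adjoin k {X} := by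
  obtain ⟨n₀, hn₀, s₀, hs₀, hn₀n, hs₀s, hf⟩ :=
    Module.End.exists_isNilpotent_isSemisimple (f := Matrix.toLin' X)
  let φ : Module.End k (n → k) ≃ₐ[k] Matrix n n k := Matrix.toLinAlgEquiv'.symm
  have hφX : φ (Matrix.toLin' X) = X := LinearMap.toMatrix'_toLin' X
  have hadj : (Algebra.adjoin k {Matrix.toLin' X}).map (φ : Module.End k (n → k) →ₐ[k] Matrix n n k) =
      Algebra.adjoin k {X} := by
    rw [AlgHom.map_adjoin, Set.image_singleton]
    exact congrArg _ (congrArg _ hφX)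
  have hS : φ s₀ ∈ Algebra.adjoin k {X} := hadj ▸ Subalgebra.mem_map.2 ⟨s₀, hs₀, rfl⟩
  have hN : φ n₀ ∈ Algebra.adjoin k {X} := hadj ▸ Subalgebra.mem_map.2 ⟨n₀, hn₀, rfl⟩
  have hXSN : X = φ s₀ + φ n₀ := by rw [← map_add, add_comm, ← hf, hφX]
  have hSs : Module.End.IsSemisimple (Matrix.toLin' (φ s₀)) := by
    have : Matrix.toLin' (φ s₀) = s₀ := Matrix.toLin'_toMatrix' s₀
    rw [this]; exact hs₀s
  have hNn : IsNilpotent (φ n₀) := hn₀n.map φ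
  have hSN : φ s₀ * φ n₀ = φ n₀ * φ s₀ := by
    rw [← map_mul, ← map_mul]
    exact congrArg φ ((Algebra.commute_of_mem_adjoin_singleton_of_commute hn₀
      (Algebra.commute_of_mem_adjoin_self hs₀).symm).symm.eq).symm
  obtain ⟨hSG, hNG⟩ := mem_lieAlgebraGL_of_isSemisimple_add_isNilpotent hX hSs hNn hSN hXSN
  exact ⟨φ s₀, φ n₀, hSG, hNG, hSs, hNn, hXSN, hS, hN⟩

end Jordan

end Literature.NumberTheory.Automorphic
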